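import Literature.Computability.AlgebraicComplexity.VNPClosedUnderCoefficients
import Mathlib.Algebra.MvPolynomial.PDeriv
import HarnessLib

/-!
# `VNP` is closed under partial derivatives (Valiant 1982; Bürgisser 2024 survey, §3.1) — PROVED
# in characteristic zero, via the first-order Taylor shift and Prop. 3.1

Topic `Computability/AlgebraicComplexity`. Cell `val-lit`, row Bur2024-A (Bürgisser 2024 survey,
arXiv:2406.06217), §3.1 "Robustness" (held text p0013 L39–L40): "Valiant also proved in
[Valiant 1982] that `VNP` is closed under `p`-bounded applications of differentiation and
integration." Companion of `VNPClosedUnderCoefficients.lean` (Prop. 3.1: `VNP` is closed under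
taking coefficients, `IsVNPFamily.coeff`) and `PermanentAsCoefficient.lean` (the survey's example
`∂/∂y₁ ⋯ ∂/∂yₙ ∏ᵢ Σⱼ x_{ij} y_j = PER_n`: `VF`, `VBP`, `VP` are NOT closed under differentiation unless
they contain `VNP`).

This file proves the basic case of the positive statement: **one partial derivative of a
p-definable family is p-definable** (`isVNPFamily_pderiv`), hence any FIXED number of them
(`isVNPFamily_pderiv_iterate`), over a field of characteristic zero (inherited from the tree's
Prop. 3.1). Route (a standard reduction to Prop. 3.1, not the survey's — the survey gives no
proof): the first-order Taylor shift `p(X_v + T)` in a fresh variable `T` (`taylorShift`, the block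
`Fin 1` of `F[Fin 1 ⊔ σ]`) satisfies `[T¹] p(X_v + T) = ∂p/∂X_v` (`coeff_single_sumAlgEquiv_taylorShift`,
by induction on `p`; `[T⁰] p(X_v + T) = p`, `coeff_zero_sumAlgEquiv_taylorShift`); the shift of a
`VNP` family is a `VNP` family (`isVNPFamily_taylorShift`: shift the `VP` witness, one extra gate
and one extra variable, Boolean summation commutes with the substitution —
`boolSum_aeval_extend`); and `VNP` is closed under taking coefficients (Prop. 3.1,
`IsVNPFamily.coeff`).

* `taylorShiftFun`, `taylorShift v` — `p ↦ p(X_v + T) ∈ R[Fin 1 ⊔ σ]` (definitions: the substitution and its `aeval`);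
* `coeff_zero_sumAlgEquiv_taylorShift`, `coeff_single_sumAlgEquiv_taylorShift` — its `T`-expansion
  starts `p + (∂_v p) T + …`;
* `isVNPFamily_taylorShift`, **`isVNPFamily_pderiv`**, `isVNPFamily_pderiv_iterate`.

TODO(general form): `p(n)`-fold derivatives along `n`-dependent words of variables (the survey's
"`p`-bounded applications") need the order-`m` Taylor coefficients `[T^m] p(X + T) = ∂^m p / m!`
for multi-indices; only fixed iteration counts are derived here. Integration is not treated.

Two definitions (`taylorShiftFun`, `taylorShift`), theorems otherwise; 0 named facts. Honest framing: closure
bookkeeping of Valiant's class; nothing here bears on `VP` versus `VNP`; `VP ≠ VNP` is NOT proved.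

## References

* [Burgisser2024Completeness] P. Bürgisser, arXiv:2406.06217 (2024), §3.1 (p0013 L39–L40).
* [Valiant1982] L. G. Valiant, *Reducibility by algebraic projections*, L'Enseignement Math. 28
  (1982), 253–268 (the source cited by the survey for this closure property).
-/

noncomputable section

open MvPolynomial

namespace Literature.Computability.AlgebraicComplexity

universe u v w

/-! ## The first-order Taylor shift `p(X_v + T)` -/

section Taylor

variable {R : Type u} [CommSemiring R] {σ : Type v} [DecidableEq σ]

/-- The substitution of the Taylor shift: `X_v ↦ T + X_v`, `X_w ↦ X_w` (`w ≠ v`), the fresh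
variable `T` being `Sum.inl 0` of `Fin 1 ⊔ σ`. [cite: Burgisser2024Completeness, §3.1 (p0013 L39–L40)] -/
def taylorShiftFun (v : σ) (w : σ) : MvPolynomial (Fin 1 ⊕ σ) R :=
  if w = v then X (Sum.inl 0) + X (Sum.inr w) else X (Sum.inr w)

/-- **The first-order Taylor shift** `p ↦ p(X_v + T)` of polynomials `p ∈ R[σ]` in the variable
`X_v`, as an `R`-algebra homomorphism into `R[Fin 1 ⊔ σ]` with `T = X_{inl 0}`: the coefficient of
`T` in `p(X_v + T)` is `∂p/∂X_v` (`coeff_single_sumAlgEquiv_taylorShift`). [cite: Burgisser2024Completeness, §3.1 (p0013 L39–L40)] -/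
def taylorShift (v : σ) : MvPolynomial σ R →ₐ[R] MvPolynomial (Fin 1 ⊕ σ) R :=
  aeval (taylorShiftFun v)

/-- `taylorShift` unfolded. [cite: Burgisser2024Completeness, §3.1 (p0013 L39–L40)] -/
theorem taylorShift_apply (v : σ) (p : MvPolynomial σ R) :
    taylorShift v p = aeval (taylorShiftFun (R := R) v) p := rfl

/-- In `R[σ][T]` (`sumAlgEquiv`), the Taylor shift is the substitution `X_v ↦ T + X_v`,
`X_w ↦ X_w` with the old variables as constants. [cite: Burgisser2024Completeness, §3.1 (p0013 L39–L40)] -/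
theorem sumAlgEquiv_taylorShift (v : σ) (p : MvPolynomial σ R) :
    sumAlgEquiv R (Fin 1) σ (taylorShift v p) =
      aeval (fun w => if w = v then X 0 + C (X w) else C (X w) :
        σ → MvPolynomial (Fin 1) (MvPolynomial σ R)) p := by
  have key : (sumAlgEquiv R (Fin 1) σ).toAlgHom.comp (taylorShift (R := R) v) =
      aeval (fun w => if w = v then X 0 + C (X w) else C (X w) :
        σ → MvPolynomial (Fin 1) (MvPolynomial σ R)) := by
    refine algHom_ext fun w => ?_
    change sumAlgEquiv R (Fin 1) σ (taylorShift v (X w)) = aeval _ (X w)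
    rw [aeval_X, taylorShift, aeval_X, taylorShiftFun]
    by_cases h : w = v
    · rw [if_pos h, if_pos h, map_add, sumAlgEquiv_X_inl, sumAlgEquiv_X_inr]
    · rw [if_neg h, if_neg h, sumAlgEquiv_X_inr]
  exact AlgHom.congr_fun key p

/-- **`[T⁰] p(X_v + T) = p`.** [cite: Burgisser2024Completeness, §3.1 (p0013 L39–L40)] -/
theorem coeff_zero_sumAlgEquiv_taylorShift (v : σ) (p : MvPolynomial σ R) :
    coeff 0 (sumAlgEquiv R (Fin 1) σ (taylorShift v p)) = p := by
  rw [sumAlgEquiv_taylorShift, ← constantCoeff_eq]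
  have key : constantCoeff.comp (aeval (fun w => if w = v then X 0 + C (X w) else C (X w) :
      σ → MvPolynomial (Fin 1) (MvPolynomial σ R))).toRingHom = RingHom.id _ := by
    refine ringHom_ext (fun c => ?_) (fun w => ?_)
    · rw [RingHom.comp_apply, AlgHom.toRingHom_eq_coe, AlgHom.coe_toRingHom, algHom_C,
        MvPolynomial.algebraMap_apply, algebraMap_eq, constantCoeff_C, RingHom.id_apply]
    · rw [RingHom.comp_apply, AlgHom.toRingHom_eq_coe, AlgHom.coe_toRingHom, aeval_X,
        RingHom.id_apply]
      by_cases h : w = v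
      · rw [if_pos h, map_add, constantCoeff_X, constantCoeff_C, zero_add]
      · rw [if_neg h, constantCoeff_C]
  exact RingHom.congr_fun key p

/-- **`[T¹] p(X_v + T) = ∂p/∂X_v`** — the derivative is the first Taylor coefficient (induction
on `p`: for `p · X_v`, `[T¹](S(p) (T + X_v)) = [T⁰] S(p) + X_v [T¹] S(p) = p + X_v ∂_v p`).
[cite: Burgisser2024Completeness, §3.1 (p0013 L39–L40)] -/
theorem coeff_single_sumAlgEquiv_taylorShift (v : σ) (p : MvPolynomial σ R) :
    coeff (Finsupp.single 0 1) (sumAlgEquiv R (Fin 1) σ (taylorShift v p)) = pderiv v p := by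
  induction p using MvPolynomial.induction_on with
  | C c =>
    rw [pderiv_C, sumAlgEquiv_taylorShift, algHom_C, MvPolynomial.algebraMap_apply, algebraMap_eq,
      coeff_C, if_neg (Finsupp.single_ne_zero.2 one_ne_zero).symm]
  | add p q hp hq =>
    rw [map_add, map_add, coeff_add, hp, hq, map_add]
  | mul_X p w hp =>
    have h0 := coeff_zero_sumAlgEquiv_taylorShift v p
    rw [sumAlgEquiv_taylorShift] at h0 hp ⊢
    rw [map_mul, aeval_X, pderiv_mul]
    by_cases h : w = v
    · subst h
      rw [if_pos rfl, mul_add, coeff_add, pderiv_X_self, mul_one,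
        show (Finsupp.single (0 : Fin 1) 1) = 0 + Finsupp.single 0 1 from (zero_add _).symm,
        coeff_mul_X, zero_add, h0, mul_comm _ (C (X w)), coeff_C_mul, hp]
      ring
    · rw [if_neg h, pderiv_X_of_ne h, mul_zero, add_zero, mul_comm _ (C (X w)), coeff_C_mul, hp,
        mul_comm]

/-- The shift substitutes polynomials of degree `≤ 1`. [cite: Burgisser2024Completeness, §3.1 (p0013 L39–L40)] -/
theorem totalDegree_taylorShiftFun_le (v w : σ) :
    (taylorShiftFun (R := R) v w).totalDegree ≤ 1 := by
  unfold taylorShiftFun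
  split_ifs
  · exact (totalDegree_add _ _).trans
      (max_le (mvPolynomial_totalDegree_X_le_one _) (mvPolynomial_totalDegree_X_le_one _))
  · exact mvPolynomial_totalDegree_X_le_one _

/-- `deg p(X_v + T) ≤ deg p`. [cite: Burgisser2024Completeness, §3.1 (p0013 L39–L40)] -/
theorem totalDegree_taylorShift_le (v : σ) (p : MvPolynomial σ R) :
    (taylorShift v p).totalDegree ≤ p.totalDegree :=
  totalDegree_aeval_le_of_le_one _ (totalDegree_taylorShiftFun_le v) p

/-- The substituted polynomials are cheap: `L(T + X_v) ≤ 1`, `L(X_w) = 0`.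
[cite: Burgisser2024Completeness, §3.1 (p0013 L39–L40)] -/
theorem complexity_taylorShiftFun_le (v w : σ) :
    complexity (taylorShiftFun (R := R) v w) ≤ if w = v then 1 else 0 := by
  unfold taylorShiftFun
  split_ifs
  · refine (complexity_add_le_holds _ _).trans ?_
    rw [complexity_X_holds, complexity_X_holds]
  · rw [complexity_X_holds]

end Taylor

/-! ## Boolean sums commute with substitutions of the free variables -/

section BoolSum

variable {R : Type u} [CommSemiring R] {σ : Type v} {ρ : Type w}

/-- Substituting `θ` into the free variables of a Valiant Boolean sum: `(Σ_e g(X, e))(θ) =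
Σ_e g'(X', e)` with `g' = g(θ(X'), e)` (the summation variables untouched).
[cite: Burgisser2000, Def. 2.5 (Boolean sums)] -/
theorem boolSum_aeval_extend {u : ℕ} (θ : σ → MvPolynomial ρ R) (g : MvPolynomial (σ ⊕ Fin u) R) :
    boolSum (aeval (Sum.elim (fun w => rename Sum.inl (θ w)) (fun j => X (Sum.inr j))) g) =
      aeval θ (boolSum g) := by
  unfold boolSum
  rw [map_sum]
  refine Finset.sum_congr rfl fun e _ => ?_
  rw [← AlgHom.comp_apply, ← AlgHom.comp_apply]
  congr 1
  refine algHom_ext fun x => ?_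
  rcases x with w | j
  · rw [AlgHom.comp_apply, AlgHom.comp_apply, aeval_X, aeval_X, Sum.elim_inl, Sum.elim_inl,
      aeval_rename, aeval_X]
    have : (Sum.elim X (fun j => if e j then (1 : MvPolynomial ρ R) else 0)) ∘ Sum.inl = X := by
      ext1; rfl
    rw [this, aeval_X_left_apply]
  · rw [AlgHom.comp_apply, AlgHom.comp_apply, aeval_X, aeval_X, Sum.elim_inr, Sum.elim_inr,
      aeval_X, Sum.elim_inr]
    split_ifs <;> simp

end BoolSum

/-! ## `VNP` is closed under the Taylor shift and under partial derivatives -/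

section Family

variable {F : Type u} [Field F] {σ : ℕ → Type v} [∀ k, Fintype (σ k)] [∀ k, DecidableEq (σ k)]

/-- **The Taylor shifts of a `VNP` family form a `VNP` family**: if `f_k = Σ_e g_k(X, e)` with
`(g_k) ∈ VP`, then `f_k(X_v + T) = Σ_e g_k(X_v + T, e)` (`boolSum_aeval_extend`), and the shifted
witnesses are again in `VP` (one more variable, degree not increased, one more gate).
[cite: Burgisser2024Completeness, §3.1 (p0013 L39–L40)] -/
theorem isVNPFamily_taylorShift {f : ∀ k, MvPolynomial (σ k) F} (hf : IsVNPFamily f)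
    (v : ∀ k, σ k) : IsVNPFamily fun k => taylorShift (v k) (f k) := by
  obtain ⟨⟨hvars, hdeg⟩, u, g, ⟨⟨gvars, gdeg⟩, gcx⟩, hfg⟩ := hf
  -- the shifted witnesses
  let θ : ∀ k, (σ k ⊕ Fin (u k)) → MvPolynomial ((Fin 1 ⊕ σ k) ⊕ Fin (u k)) F := fun k =>
    Sum.elim (fun w => rename Sum.inl (taylorShiftFun (v k) w)) (fun j => X (Sum.inr j))
  have hθdeg : ∀ k x, (θ k x).totalDegree ≤ 1 := by
    intro k x
    rcases x with w | j
    · exact (totalDegree_rename_le _ _).trans (totalDegree_taylorShiftFun_le (v k) w)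
    · exact mvPolynomial_totalDegree_X_le_one _
  have hθcx : ∀ k, ∑ x, complexity (θ k x) ≤ 1 := by
    intro k
    rw [Fintype.sum_sum_type]
    have h2 : ∑ j : Fin (u k), complexity (θ k (Sum.inr j)) = 0 :=
      Finset.sum_eq_zero fun j _ => complexity_X_holds _
    have h1 : ∑ w : σ k, complexity (θ k (Sum.inl w)) ≤ ∑ w : σ k, if w = v k then 1 else 0 :=
      Finset.sum_le_sum fun w _ =>
        (complexity_rename_le_holds' _ _).trans (complexity_taylorShiftFun_le (v k) w)
    rw [Finset.sum_ite_eq', if_pos (Finset.mem_univ _)] at h1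
    omega
  refine ⟨⟨(IsPBounded.add_holds hvars (IsPBounded.const 1)).mono fun k => ?_,
      hdeg.mono fun k => totalDegree_taylorShift_le _ _⟩,
    u, fun k => aeval (θ k) (g k),
    ⟨⟨(IsPBounded.add_holds gvars (IsPBounded.const 1)).mono fun k => ?_,
        gdeg.mono fun k => totalDegree_aeval_le_of_le_one _ (hθdeg k) _⟩,
      (IsPBounded.add_holds gcx (IsPBounded.const 1)).mono fun k =>
        (complexity_aeval_le (g k) (θ k)).trans (Nat.add_le_add_left (hθcx k) _)⟩,
    fun k => ?_⟩
  · simp only [Fintype.card_sum, Fintype.card_fin]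
    omega
  · simp only [Fintype.card_sum, Fintype.card_fin]
    omega
  · show taylorShift (v k) (f k) = boolSum (aeval (θ k) (g k))
    rw [hfg k, taylorShift_apply, ← boolSum_aeval_extend]

variable [CharZero F]

/-- **`VNP` is closed under partial derivatives** (Valiant 1982; Bürgisser 2024, §3.1),
characteristic zero: if `(f_k)` is p-definable then so is `(∂f_k/∂X_{v_k})` for any choice of
variables `v_k`. Proof: `∂_v f = [T¹] f(X_v + T)` (`coeff_single_sumAlgEquiv_taylorShift`), the
shifted family is in `VNP` (`isVNPFamily_taylorShift`), and `VNP` is closed under taking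
coefficients (Prop. 3.1, `IsVNPFamily.coeff`). [cite: Burgisser2024Completeness, §3.1 (p0013 L39–L40)] [cite: Valiant1982, §3] -/
theorem isVNPFamily_pderiv {f : ∀ k, MvPolynomial (σ k) F} (hf : IsVNPFamily f) (v : ∀ k, σ k) :
    IsVNPFamily fun k => MvPolynomial.pderiv (v k) (f k) := by
  have h := IsVNPFamily.coeff (a := fun _ => 1) (τ := σ) (isVNPFamily_taylorShift hf v)
    fun _ => Finsupp.single 0 1
  refine (iff_of_eq (congrArg IsVNPFamily (funext fun k => ?_))).1 h
  exact coeff_single_sumAlgEquiv_taylorShift (v k) (f k)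

/-- Any fixed number `r` of partial derivatives keeps a p-definable family p-definable.
[cite: Burgisser2024Completeness, §3.1 (p0013 L39–L40)] -/
theorem isVNPFamily_pderiv_iterate {f : ∀ k, MvPolynomial (σ k) F} (hf : IsVNPFamily f)
    (v : ∀ k, σ k) (r : ℕ) :
    IsVNPFamily fun k => (MvPolynomial.pderiv (v k))^[r] (f k) := by
  induction r with
  | zero => exact hf
  | succ r ih =>
    have h := isVNPFamily_pderiv ih v
    refine (iff_of_eq (congrArg IsVNPFamily (funext fun k => ?_))).1 h
    exact (Function.iterate_succ_apply' _ r (f k)).symm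

end Family

end Literature.Computability.AlgebraicComplexity

end
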